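import Summits.AtomisticToContinuum.Crystallization.Theorems.OverbindingBudgetAffineNearClusterBT
import Summits.AtomisticToContinuum.Crystallization.Theorems.ExcessDecayLiouvilleFarField

/-!
# OverbindingBudget — slot D · `DefectPairFloor` PROVED, and the slot-3 cones with the D (and BT) slots dropped

decomp-a2c prover hand-1 (generation 18), (S)-lane.  File B of the affine harmonic line
(`…Theorems.OverbindingBudgetAffineLocalisation`, lens-4 g43) types the registration-free piece

  `DefectPairFloor : ∀ δ > 0, ∃ C ≥ 0, ∀ N y, y injective → ∀ B, (∀ i ∉ B, δ ≤ nearestDist y i) →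
      −C·#B ≤ ½·(pairSum B univ y + pairSum Bᶜ B y)`

(TRUE-type · ATTACKABLE-S/M: all ordered pairs touching the class `B` cost at most `C(δ)` per site of `B`).  Proof, as announced in
file B's docstring: `pairSum B univ = pairSum B B + pairSum B Bᶜ`; the tree's chunk floor `card_mul_floor_le_half_pairSum`
(`#B·e⋆ ≤ ½·pairSum B B`, `e⋆` the periodic infimum — a fixed real, so `max 0 (−e⋆)` per site suffices, no stability constant is
needed); and for each `j ∈ B` the sites of `Bᶜ` are pairwise `δ`-separated and `δ`-far from `y j` (`nearestDist ≥ δ` off `B`), so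
`Σ_{i ∉ B} V(|y i − y j|) ≥ −(1/6)·Σ |y i − y j|⁻⁶ ≥ −(1/6)·1024/δ⁶` by `V ≥ −r⁻⁶/6` and the far-field packing bound
`…ExcessDecayLiouville.sum_inv_pow_le_of_separated` (`k = 3`, `R = δ`).  Constant: `C(δ) = max 0 (−e⋆) + 1024/(6δ⁶)` (each orientation contributes `½·1024/(6δ⁶)` per site of `B`).
Consequences: cone LI / LII / LIII and the record cone without the D slot (`…_d`), and without D and BT (`…_bt_d`).
No definitions, no `sorry`, standard axioms.  `--supports stmt-AtomisticToContinuum-31280`.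
-/

noncomputable section

namespace Summit.AtomisticToContinuum.Crystallization.Theorems.OverbindingBudgetAffineLocalisation

open scoped BigOperators Classical
open Literature.MathematicalPhysics.StatisticalMechanics (lennardJones PeriodicConfiguration)
open Literature.Geometry.DiscreteGeometry (nearestDist nearestDist_le_dist)
open Summit.AtomisticToContinuum.Crystallization.Theorems.ExcessDecayLiouville (sum_inv_pow_le_of_separated)
open Summit.AtomisticToContinuum.Crystallization.Theorems.OverbindingBudgetBalancedCensusStatements
  (TameBalancedDeepScaleGap)
open Summit.AtomisticToContinuum.Crystallization.Theorems.OverbindingBudgetLocalHarmonicCertificate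
open Summit.AtomisticToContinuum.Crystallization.Theorems.OverbindingBudgetAffineLadder
open Summit.AtomisticToContinuum.Crystallization.Theorems.OverbindingBudgetAffineNearCluster

variable {N : ℕ}

/-! ## §1  The off-class pair sum into one class site -/

/-- **Off-class floor at one site.**  If every site off `B` has `nearestDist ≥ δ > 0`, then for `j ∈ B`
`Σ_{i ∉ B} V(|y i − y j|) ≥ −1024/(6δ⁶)`: the off-class sites are pairwise `δ`-separated and `δ`-far from `y j`,
`V ≥ −r⁻⁶/6`, and `Σ |y i − y j|⁻⁶ ≤ 1024/(δ³·δ³)` (`sum_inv_pow_le_of_separated`, `k = 3`, `R = δ`). [this file] -/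
theorem sum_compl_lennardJones_ge {δ : ℝ} (hδ : 0 < δ) {y : Fin N → EuclideanSpace ℝ (Fin 3)}
    (hy : Function.Injective y) {B : Finset (Fin N)} (hB : ∀ i : Fin N, i ∉ B → δ ≤ nearestDist y i)
    {j : Fin N} (hj : j ∈ B) :
    -(1024 / (6 * δ ^ 6)) ≤ ∑ i ∈ Bᶜ, lennardJones (dist (y i) (y j)) := by
  -- pass to the image point set
  have himg : ∑ i ∈ Bᶜ, lennardJones (dist (y i) (y j)) =
      ∑ a ∈ (Bᶜ : Finset (Fin N)).image y, lennardJones (dist a (y j)) := by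
    rw [Finset.sum_image fun i _ k _ h => hy h]
  have hsep : ∀ a ∈ (Bᶜ : Finset (Fin N)).image y, ∀ b ∈ (Bᶜ : Finset (Fin N)).image y, a ≠ b → δ ≤ dist a b := by
    intro a ha b hb hab
    obtain ⟨i, hi, rfl⟩ := Finset.mem_image.1 ha
    obtain ⟨k, hk, rfl⟩ := Finset.mem_image.1 hb
    have hik : k ≠ i := fun h => hab (by rw [h])
    exact (hB i (Finset.mem_compl.1 hi)).trans (nearestDist_le_dist y hik)
  have hfar : ∀ a ∈ (Bᶜ : Finset (Fin N)).image y, δ ≤ dist a (y j) := by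
    intro a ha
    obtain ⟨i, hi, rfl⟩ := Finset.mem_image.1 ha
    have hji : j ≠ i := fun h => (Finset.mem_compl.1 hi) (h ▸ hj)
    exact (hB i (Finset.mem_compl.1 hi)).trans (nearestDist_le_dist y hji)
  have hpack := sum_inv_pow_le_of_separated ((Bᶜ : Finset (Fin N)).image y) (y j) (k := 3)
    (by norm_num) hδ le_rfl hsep hfar
  have hV : ∀ a : EuclideanSpace ℝ (Fin 3),
      -((1 / 6) * (dist a (y j))⁻¹ ^ (3 + 3)) ≤ lennardJones (dist a (y j)) := by
    intro a
    unfold lennardJones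
    have h0 : 0 ≤ (1 / 12 : ℝ) * (dist a (y j))⁻¹ ^ 12 := by positivity
    have h6 : (dist a (y j))⁻¹ ^ (3 + 3) = (dist a (y j))⁻¹ ^ 6 := by norm_num
    rw [h6]
    linarith
  have hsum : -((1 / 6) * ∑ a ∈ (Bᶜ : Finset (Fin N)).image y, (dist a (y j))⁻¹ ^ (3 + 3)) ≤
      ∑ a ∈ (Bᶜ : Finset (Fin N)).image y, lennardJones (dist a (y j)) := by
    rw [Finset.mul_sum, ← Finset.sum_neg_distrib]
    exact Finset.sum_le_sum fun a _ => hV a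
  have hδ6 : δ ^ 3 * δ ^ 3 = δ ^ 6 := by ring
  rw [hδ6] at hpack
  have h16 : -(1024 / (6 * δ ^ 6)) ≤ -((1 / 6) * ∑ a ∈ (Bᶜ : Finset (Fin N)).image y, (dist a (y j))⁻¹ ^ (3 + 3)) := by
    have : (1 / 6 : ℝ) * ∑ a ∈ (Bᶜ : Finset (Fin N)).image y, (dist a (y j))⁻¹ ^ (3 + 3) ≤ 1024 / (6 * δ ^ 6) := by
      rw [show (1024 : ℝ) / (6 * δ ^ 6) = 1 / 6 * (1024 / δ ^ 6) by field_simp]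
      exact mul_le_mul_of_nonneg_left hpack (by norm_num)
    linarith
  rw [himg]
  exact h16.trans hsum

/-! ## §2  D PROVED -/

/-- **D · `DefectPairFloor` PROVED** with `C(δ) = max 0 (−e⋆) + 1024/(6δ⁶)`: `½·pairSum B univ + ½·pairSum Bᶜ B
= ½·pairSum B B + ½·pairSum B Bᶜ + ½·pairSum Bᶜ B ≥ e⋆·#B − ½·(1024/(6δ⁶))·#B − ½·(1024/(6δ⁶))·#B` by the chunk floor
`card_mul_floor_le_half_pairSum` and `sum_compl_lennardJones_ge` at every site of `B` (both orientations, `dist` symmetric).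
[this file; BlancLewin2015 §1.3 for the route] -/
theorem defectPairFloor_holds : DefectPairFloor := by
  intro δ hδ
  refine ⟨max 0 (-(⨅ Q : PeriodicConfiguration 3, Q.energyPerParticle lennardJones)) + 1024 / (6 * δ ^ 6),
    by positivity, fun N y hy B hB => ?_⟩
  have hsplit : pairSum B Finset.univ y = pairSum B B y + pairSum B Bᶜ y := by
    unfold pairSum
    rw [← Finset.sum_add_distrib]
    refine Finset.sum_congr rfl fun i _ => ?_
    rw [← Finset.sum_union (disjoint_compl_right (a := B)), Finset.union_compl]
  have h1 := card_mul_floor_le_half_pairSum hy B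
  have h2 : -(1024 / (6 * δ ^ 6)) * (B.card : ℝ) ≤ pairSum B Bᶜ y := by
    unfold pairSum
    have hi : ∀ i ∈ B, -(1024 / (6 * δ ^ 6)) ≤ ∑ j ∈ Bᶜ, lennardJones (dist (y i) (y j)) := by
      intro i hi
      have h := sum_compl_lennardJones_ge hδ hy hB hi
      simpa only [dist_comm] using h
    calc -(1024 / (6 * δ ^ 6)) * (B.card : ℝ) = ∑ _i ∈ B, (-(1024 / (6 * δ ^ 6)) : ℝ) := by
          rw [Finset.sum_const, nsmul_eq_mul, mul_comm]
      _ ≤ _ := Finset.sum_le_sum hi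
  have h3 : -(1024 / (6 * δ ^ 6)) * (B.card : ℝ) ≤ pairSum Bᶜ B y := by
    unfold pairSum
    rw [Finset.sum_comm]
    calc -(1024 / (6 * δ ^ 6)) * (B.card : ℝ) = ∑ _j ∈ B, (-(1024 / (6 * δ ^ 6)) : ℝ) := by
          rw [Finset.sum_const, nsmul_eq_mul, mul_comm]
      _ ≤ _ := Finset.sum_le_sum fun j hj => sum_compl_lennardJones_ge hδ hy hB hj
  have h4 : -(max 0 (-(⨅ Q : PeriodicConfiguration 3, Q.energyPerParticle lennardJones))) * (B.card : ℝ) ≤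
      (B.card : ℝ) * (⨅ Q : PeriodicConfiguration 3, Q.energyPerParticle lennardJones) := by
    have hm := le_max_right (0 : ℝ) (-(⨅ Q : PeriodicConfiguration 3, Q.energyPerParticle lennardJones))
    have hc : (0 : ℝ) ≤ B.card := Nat.cast_nonneg _
    nlinarith
  rw [hsplit]
  have hc : (0 : ℝ) ≤ B.card := Nat.cast_nonneg _
  have hδ6 : (0 : ℝ) ≤ 1024 / (6 * δ ^ 6) := by positivity
  nlinarith [h1, h2, h3, h4, hc, hδ6]

/-! ## §3  Cones with the D slot discharged -/

/-- **CONE LI without the D slot (PROVED):** `K_bent R → R_aff → N R ρ₁ θ θ₀ κ → Z ρ₁ θ θ₀ κ → AffMidAll ρ₁ θ → TBDSG`.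
[this file: `defectPairFloor_holds` in file B's `tbdsg_of_affineLocalisation`] -/
theorem tbdsg_of_affineLocalisation_d (R ρ₁ θ θ₀ κ : ℝ) (hK : BentReferenceStability R) (hR : AffineChartStraightening)
    (hN : NearClusterFloor R ρ₁ θ θ₀ κ) (hZ : FarAggregatePricing ρ₁ θ θ₀ κ) (hM : AffMidAll ρ₁ θ) :
    TameBalancedDeepScaleGap (122 / 125) 0 4 (3 / 50) (1 / 450) :=
  tbdsg_of_affineLocalisation R ρ₁ θ θ₀ κ hK hR defectPairFloor_holds hN hZ hM

/-- **CONE LIII without the BT and D slots (PROVED):**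
`0 < η → (∃ μ₁ μR > 0, K_at⁰ η μ₁ μR R) → R_aff → RD01(…,κ₁) → N2(…,κ₂) → δm < 1 → κ₁ + κ₂ ≤ κ → Z ρ₁ θ θ₀ κ → AffMidAll ρ₁ θ → TBDSG`.
[this file: `defectPairFloor_holds` in `tbdsg_of_nearOrders_bt`] -/
theorem tbdsg_of_nearOrders_bt_d (η R Rc δm ρ₁ θ θ₀ κ₁ κ₂ κ : ℝ) (hη : 0 < η)
    (hK : ∃ μ₁ μR : ℝ, 0 < μ₁ ∧ 0 < μR ∧ PureMarginStabilityAt η μ₁ μR R) (hR : AffineChartStraightening)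
    (h01 : NearReferenceLowOrders η R Rc δm ρ₁ θ θ₀ κ₁)
    (h2 : NearSecondOrderFloor η R Rc δm ρ₁ θ θ₀ κ₂) (hδm : δm < 1) (hκ : κ₁ + κ₂ ≤ κ) (hZ : FarAggregatePricing ρ₁ θ θ₀ κ)
    (hM : AffMidAll ρ₁ θ) : TameBalancedDeepScaleGap (122 / 125) 0 4 (3 / 50) (1 / 450) :=
  tbdsg_of_nearOrders_bt η R Rc δm ρ₁ θ θ₀ κ₁ κ₂ κ hη hK hR defectPairFloor_holds h01 h2 hδm hκ hZ hM

/-- **CONE LIII at the (row 670) record literals without the BT and D slots (PROVED):** `η = 3/2000`, `R = 4`, `Rc = 6`, `δm = 1/1000`,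
`ρ₁ = 12`, `θ = 1/25`, `θ₀ = 1/2000`, `κ₁ = κ₂ = 1/(2·10⁶)`, `κ = 1/10⁶`; remaining slots K_at⁰, R_aff, RD01, N2, Z, AffMidAll.
(The κ re-cut of critic row 677 lives in `…OverbindingBudgetAffineNearCritical`; this cone keeps row 670's literals.)
[this file: `defectPairFloor_holds` in `tbdsg_of_nearOrders_record_bt`] -/
theorem tbdsg_of_nearOrders_record_bt_d
    (hK : ∃ μ₁ μR : ℝ, 0 < μ₁ ∧ 0 < μR ∧ PureMarginStabilityAt (3 / 2000) μ₁ μR 4) (hR : AffineChartStraightening)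
    (h01 : NearReferenceLowOrders (3 / 2000) 4 6 (1 / 1000) 12 (1 / 25) (1 / 2000) (1 / (2 * 10 ^ 6)))
    (h2 : NearSecondOrderFloor (3 / 2000) 4 6 (1 / 1000) 12 (1 / 25) (1 / 2000) (1 / (2 * 10 ^ 6)))
    (hZ : FarAggregatePricing 12 (1 / 25) (1 / 2000) (1 / 10 ^ 6)) (hM : AffMidAll 12 (1 / 25)) :
    TameBalancedDeepScaleGap (122 / 125) 0 4 (3 / 50) (1 / 450) :=
  tbdsg_of_nearOrders_record_bt hK hR defectPairFloor_holds h01 h2 hZ hM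

end Summit.AtomisticToContinuum.Crystallization.Theorems.OverbindingBudgetAffineLocalisation
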